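import Mathlib.Algebra.MvPolynomial.Basic
import Mathlib.Data.Complex.Basic
import HarnessLib

/-!
# Coefficients of matching sums (support for `FifoMatching.TimeCutFoolingSet`)

Helper toward route item `stmt-ValiantsHypothesis-11621` (`Theses.FifoMatching.TimeCutFoolingSet`),
the coefficient side of the fooling-set argument: in a matching sum
`Σ_{M : P M} ∏_{i < M i} x_{i, M i}` over fixed-point-free involutions, the coefficient of the
indicator monomial `∏_{e ∈ F} x_e` of an arc set `F` is `1` if `F` is the arc set of some matching
`M` with `P M`, and `0` otherwise (`coeff_arcIndicator_sum_matchings`): each summand is the monomial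
of its arc set, and a fixed-point-free involution is determined by its arcs. [folklore]
-/

noncomputable section

-- layout Summits/ValiantsHypothesis/ValiantsHypothesis forces the duplicated namespace component
set_option linter.dupNamespace false

namespace Summit.ValiantsHypothesis.ValiantsHypothesis.Theorems.FifoMatching

open MvPolynomial

universe u

variable {R : Type u} [CommSemiring R] {N : ℕ}

/-- The arc set `{(i, M i) : i < M i}` of a self-map. [folklore] -/
def arcs (M : Fin N → Fin N) : Finset (Fin N × Fin N) :=
  (Finset.univ.filter fun i : Fin N => i < M i).image fun i => (i, M i)

/-- The indicator exponent vector `Σ_{e ∈ F} e` of a set of variables. [folklore] -/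
def arcIndicator (F : Finset (Fin N × Fin N)) : (Fin N × Fin N) →₀ ℕ :=
  ∑ e ∈ F, Finsupp.single e 1

/-- Values of the indicator. [folklore] -/
theorem arcIndicator_apply (F : Finset (Fin N × Fin N)) (a : Fin N × Fin N) :
    arcIndicator F a = if a ∈ F then 1 else 0 := by
  classical
  unfold arcIndicator
  rw [Finsupp.finsetSum_apply]
  simp only [Finsupp.single_apply]
  rw [Finset.sum_ite_eq']

/-- The indicator determines the set. [folklore] -/
theorem arcIndicator_injective {F G : Finset (Fin N × Fin N)} (h : arcIndicator F = arcIndicator G) :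
    F = G := by
  ext a
  have := congrArg (fun v => v a) h
  simp only [arcIndicator_apply] at this
  by_cases hF : a ∈ F <;> by_cases hG : a ∈ G <;> simp_all

/-- Membership in the arc set. [folklore] -/
theorem mem_arcs {M : Fin N → Fin N} {e : Fin N × Fin N} :
    e ∈ arcs M ↔ e.1 < M e.1 ∧ e.2 = M e.1 := by
  unfold arcs
  simp only [Finset.mem_image, Finset.mem_filter, Finset.mem_univ, true_and]
  constructor
  · rintro ⟨i, hi, rfl⟩; exact ⟨hi, rfl⟩
  · rintro ⟨h1, h2⟩; exact ⟨e.1, h1, by rw [← h2]⟩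

/-- **The matching weight is the monomial of its arc set.** [folklore] -/
theorem prod_arcs_eq_monomial (M : Fin N → Fin N) :
    (∏ i : Fin N, (if i < M i then X (i, M i) else 1) : MvPolynomial (Fin N × Fin N) R) =
      monomial (arcIndicator (arcs M)) 1 := by
  classical
  rw [← Finset.prod_filter, arcIndicator, arcs, Finset.sum_image, monomial_sum_one]
  · rfl
  · intro i _ j _ h
    exact (Prod.mk.injEq _ _ _ _).mp h |>.1

/-- **A fixed-point-free involution is determined by its arcs.** [folklore] -/
theorem eq_of_arcs_eq {M M' : Fin N → Fin N} (hM : ∀ i, M (M i) = i) (hM0 : ∀ i, M i ≠ i)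
    (hM' : ∀ i, M' (M' i) = i) (h : arcs M = arcs M') : M = M' := by
  -- openers of `M` are openers of `M'` with the same partner
  have key : ∀ i, i < M i → M' i = M i := fun i hi => by
    have : (i, M i) ∈ arcs M' := h ▸ mem_arcs.mpr ⟨hi, rfl⟩
    exact (mem_arcs.mp this).2.symm
  funext i
  rcases lt_or_gt_of_ne (hM0 i).symm with hi | hi
  · exact (key i hi).symm
  · -- `i` is a closer of `M`: its partner `M i` is an opener
    have h1 : M i < M (M i) := by rw [hM]; exact hi
    have h2 := key (M i) h1
    rw [hM] at h2
    -- `M' (M i) = i`, hence `M' i = M i`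
    have := congrArg M' h2
    rw [hM'] at this
    exact this

open scoped Classical in
/-- **Coefficient extraction:** in `Σ_{P M} ∏_{i<M i} x_{i,M i}` (over fixed-point-free involutions)
the coefficient of the indicator monomial of `F` is `1` if `F` is the arc set of a matching in the
sum and `0` otherwise. [folklore] -/
theorem coeff_arcIndicator_sum_matchings (P : (Fin N → Fin N) → Prop)
    (hP : ∀ M, P M → (∀ i, M (M i) = i) ∧ ∀ i, M i ≠ i) (F : Finset (Fin N × Fin N)) :
    coeff (arcIndicator F) (∑ M : Fin N → Fin N,
      if P M then ∏ i : Fin N, (if i < M i then X (i, M i) else 1)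
      else (0 : MvPolynomial (Fin N × Fin N) R)) =
      if ∃ M, P M ∧ arcs M = F then 1 else 0 := by
  rw [coeff_sum]
  have hterm : ∀ M : Fin N → Fin N, coeff (arcIndicator F)
      (if P M then ∏ i : Fin N, (if i < M i then X (i, M i) else 1)
        else (0 : MvPolynomial (Fin N × Fin N) R)) =
      if P M ∧ arcs M = F then 1 else 0 := fun M => by
    by_cases hPM : P M
    · rw [if_pos hPM, prod_arcs_eq_monomial, coeff_monomial]
      by_cases hA : arcs M = F
      · rw [if_pos (by rw [hA]), if_pos ⟨hPM, hA⟩]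
      · rw [if_neg (fun h => hA (arcIndicator_injective h)), if_neg (fun h => hA h.2)]
    · rw [if_neg hPM, coeff_zero, if_neg (fun h => hPM h.1)]
  simp_rw [hterm]
  rw [Finset.sum_boole]
  -- at most one matching has arc set `F`
  have hle : (Finset.univ.filter fun M : Fin N → Fin N => P M ∧ arcs M = F).card ≤ 1 := by
    refine Finset.card_le_one.mpr fun M hM M' hM' => ?_
    simp only [Finset.mem_filter, Finset.mem_univ, true_and] at hM hM'
    exact eq_of_arcs_eq (hP M hM.1).1 (hP M hM.1).2 (hP M' hM'.1).1 (hM.2.trans hM'.2.symm)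
  split_ifs with hex
  · obtain ⟨M, hM⟩ := hex
    have hpos : 0 < (Finset.univ.filter fun M : Fin N → Fin N => P M ∧ arcs M = F).card :=
      Finset.card_pos.mpr ⟨M, by simpa using hM⟩
    have : (Finset.univ.filter fun M : Fin N → Fin N => P M ∧ arcs M = F).card = 1 := by omega
    rw [this, Nat.cast_one]
  · have : (Finset.univ.filter fun M : Fin N → Fin N => P M ∧ arcs M = F) = ∅ :=
      Finset.filter_eq_empty_iff.mpr fun M _ h => hex ⟨M, h⟩
    rw [this, Finset.card_empty, Nat.cast_zero]

open scoped Classical in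
/-- **The item's instance:** coefficients of the nest-free (FIFO) matching sum `NN_n` of route
`FifoMatching` — the coefficient of `∏_{e ∈ F} x_e` is `1` iff `F` is the arc set of a nonnesting
fixed-point-free involution of `Fin (2n)`, else `0`. [folklore] -/
theorem coeff_indicator_nnSum (n : ℕ) (F : Finset (Fin (2 * n) × Fin (2 * n))) :
    MvPolynomial.coeff (∑ e ∈ F, Finsupp.single e 1) (∑ M : Fin (2 * n) → Fin (2 * n),
      if ((∀ i, M (M i) = i) ∧ (∀ i, M i ≠ i) ∧ ∀ i j, i < j → j < M j → M j < M i → False) then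
        ∏ i : Fin (2 * n), (if i < M i then MvPolynomial.X (i, M i) else 1)
      else (0 : MvPolynomial (Fin (2 * n) × Fin (2 * n)) ℂ)) =
      if ∃ M : Fin (2 * n) → Fin (2 * n),
          ((∀ i, M (M i) = i) ∧ (∀ i, M i ≠ i) ∧ ∀ i j, i < j → j < M j → M j < M i → False) ∧
            arcs M = F then 1 else 0 := by
  have h := coeff_arcIndicator_sum_matchings (R := ℂ)
    (fun M : Fin (2 * n) → Fin (2 * n) =>
      (∀ i, M (M i) = i) ∧ (∀ i, M i ≠ i) ∧ ∀ i j, i < j → j < M j → M j < M i → False)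
    (fun M h => ⟨h.1, h.2.1⟩) F
  simp only [arcIndicator] at h
  convert h

end Summit.ValiantsHypothesis.ValiantsHypothesis.Theorems.FifoMatching

end
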